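import Summits.AtomisticToContinuum.BoseEinsteinCondensation.Theorems.BECGroundStateSOSPeriodicIRBoundReductionBounded
import Summits.AtomisticToContinuum.BoseEinsteinCondensation.Theorems.BECSectorPoincareTwoScaleLandauToPeriodicBECModeCounting
import HarnessLib

/-!
# Route `BECNoCheapMomentum`, support item `FreeGasCondensation` (stmt-AtomisticToContinuum-11847)

The a.e.-free gas (`∫ v(|x|)dx = 0`) condenses on the torus: `v^per = 0` a.e. on the cell, so the periodic
energy is the kinetic energy and `E₀^per = 0`; the fixed-`(N,L)` zero-momentum gap and the T = 0 infrared bound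
are the free ones (landed: `zeroMomentumGapFor_of_lintegral_eq_zero`, and the Wagner–Feynman chain
`irBoundFor_of_linearFloor_of_gap` whose floor hypothesis is void when `∫v = 0`), and mode counting per potential
(`LandauToPeriodicBEC.periodicBEC_of_irBoundFor`, helper of the bridge item stmt-9095 of the sibling route
`BECSectorPoincareTwoScale`) gives `n₀ ≥ N/2` for the `δ_N`-near-minimisers. [LSSY2005 §1.2; PenroseOnsager1956]
-/

noncomputable section

open scoped ENNReal
open MeasureTheory

namespace Summit.AtomisticToContinuum.BoseEinsteinCondensation.Theorems

open Literature.MathematicalPhysics.QuantumManyBody.BoseGas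
open Summit.AtomisticToContinuum.BoseEinsteinCondensation.Theses.BECNoCheapMomentum (FreeGasCondensation)
open Summit.AtomisticToContinuum.BoseEinsteinCondensation.Cruxes.PeriodicIRBound.LinearPhFloorWagner
  (irBoundFor_of_linearFloor_of_gap)
open Summit.AtomisticToContinuum.BoseEinsteinCondensation.Theorems.PeriodicIRBound.Negative
  (zeroMomentumGapFor_of_lintegral_eq_zero)

/-- **Route `BECNoCheapMomentum`, item `FreeGasCondensation` (stmt-AtomisticToContinuum-11847)**: for every
repulsive finite-range `v` with `∫ v(|x|)dx = 0` the `PeriodicBEC` body holds (`c = 1/2`, `δ_N` after `N`):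
the a.e.-free gas on the torus condenses into the constant mode. [cite: LSSY2005, §1.2 (1.17)–(1.19)] -/
theorem FreeGasCondensation_proof : FreeGasCondensation :=
  fun v hv h0 => LandauToPeriodicBEC.periodicBEC_of_irBoundFor v hv
    (irBoundFor_of_linearFloor_of_gap v hv (ne_of_eq_of_ne h0 ENNReal.zero_ne_top)
      (fun h => absurd h0 h) (zeroMomentumGapFor_of_lintegral_eq_zero hv.1 h0))

end Summit.AtomisticToContinuum.BoseEinsteinCondensation.Theorems

end
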